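import Literature.Computability.Complexity.FoldBricks
import Literature.Computability.Complexity.IntVectorBricks
import Literature.Computability.Complexity.LengthCompare
import HarnessLib

/-!
# Guess-and-verify over polynomially many guarded sub-queries: the polynomial-time stages

Trunk `CplxCore`, brick assembly (no machine is programmed). Second of three files
(`RootClock`, `GuardedBallStages`, `NSUBEXPGuardedBall`) proving the closure of
`NSUBEXP = ⋂_{r>0} NTIME(2^{⌊n^{1/r}⌋})` (`NSubexp.lean`) under an existential polynomial guess
followed by polynomially many guarded membership queries to an `NSUBEXP` language
(`mem_NSUBEXP_of_guardedBall`, `NSUBEXPGuardedBall.lean`) — the verifier form of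
Kabanets–Impagliazzo 2003, Lemma 3 ("if `Perm ∈ NTIME(t)` then `P^{Perm} ⊆ NTIME(poly · t ∘ poly)`":
guess every oracle answer together with its certificate and verify them one by one).

The verifier of that file receives `X₀ = ⟨x, c⟩` (`c` the certificate cut to admissible length,
read as `c = ⟨Y, Zs⟩`: the polynomial guess `Y` and the list `Zs` of sub-certificates, `body`
coding of `CookReducibilityTransitive.lean`) and runs three string functions of this file, all in
`FP` and specified on the intended inputs:

* `GuardedBall.genFn` — the **generator**: from `⟨x, c⟩` the concatenation of the one-entry codes
  `⟨item j, ε⟩`, `j < |w|`, `w = ⟨x, Y⟩`, of the round words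
  `item j = ⟨⟨w, 1ʲ⟩, Zs[j]⟩` (`genFn_apply`; a clipped concatenation fold `Brick.foldLoop` of
  `FoldBricks.lean` over the list access `PRelSigPi.elemFn`, sized by `Brick.length_elemOf_le` of
  `IntVectorBricks.lean`);
* `GuardedBall.g1Fn R S f p` — the **round analyser**: on `⟨⟨w, J⟩, z⟩` with `w = ⟨x, Y⟩`, if the
  guard `|Y| ≤ p(|x|) ∧ w ∈ R` fails it emits the complaint `⟨[1], [0]⟩`; otherwise, if
  `⟨w, J⟩ ∈ S` it emits the task `⟨f ⟨w, J⟩, 1 z⟩` (the flag `1` travels in front of the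
  certificate), else the idle word `⟨[0], [0]⟩` (`g1Fn_apply`);
* `GuardedBall.g2Fn` — the **flag reader** after truncation: `⟨t, 1 z⟩ ↦ 1 ⟨t, z⟩` (run the inner
  verifier) and `⟨t, 0 _⟩ ↦ [0, t.head]` (answer directly) (`g2Fn_true`, `g2Fn_false`).

## References

* V. Kabanets, R. Impagliazzo, *Derandomizing polynomial identity tests means proving circuit
  lower bounds*, STOC 2003, Lemma 3 (p. 357).
* S. Arora, B. Barak, *Computational Complexity: A Modern Approach*, CUP 2009, §1.3 (polynomial
  time is closed under composition and bounded loops), Def. 2.1 (certificates).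
-/

namespace Literature.Computability.Complexity

open _root_.Computability Polynomial Brick PRelSigPi

namespace GuardedBall

/-! ### Concatenations of indexed pieces as `flatMap`s -/

/-- `ccat g k` is the `flatMap` of `g` over `[0, …, k-1]` (twin of `flatMap_range_eq_ccat` of
`QuantumComplexity/CWrapUniform.lean`, which sits above this toolkit; a librarian may hoist both next to
`ccat` in `EncodingFrames.lean`). [folklore] -/
theorem ccat_eq_flatMap_range (g : ℕ → List Bool) : ∀ k : ℕ, ccat g k = (List.range k).flatMap g
  | 0 => rfl
  | k + 1 => by
    rw [ccat_succ, ccat_eq_flatMap_range g k, List.range_succ, List.flatMap_append]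
    simp

/-! ### Accessors of `X₀ = ⟨x, c⟩`, `c` read as `⟨Y, Zs⟩` -/

/-- The input `x` of `⟨x, c⟩`. [folklore] -/
def xOf : List Bool → List Bool := fstF

/-- The guess `Y` of `⟨x, ⟨Y, Zs⟩⟩`. [folklore] -/
def yOf : List Bool → List Bool := fstF ∘ sndF

/-- The certificate list `Zs` of `⟨x, ⟨Y, Zs⟩⟩`. [folklore] -/
def zsOf : List Bool → List Bool := sndF ∘ sndF

/-- The guarded word `w = ⟨x, Y⟩` of `⟨x, ⟨Y, Zs⟩⟩`. [folklore] -/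
noncomputable def wOf : List Bool → List Bool := fanoutFn xOf yOf

/-- `xOf ⟨x, c⟩ = x`. [folklore] -/
@[simp] theorem xOf_boolPair (x c : List Bool) : xOf (boolPair x c) = x := by simp [xOf]

/-- `yOf ⟨x, c⟩ = fstF c`. [folklore] -/
@[simp] theorem yOf_boolPair (x c : List Bool) : yOf (boolPair x c) = fstF c := by simp [yOf]

/-- `zsOf ⟨x, c⟩ = sndF c`. [folklore] -/
@[simp] theorem zsOf_boolPair (x c : List Bool) : zsOf (boolPair x c) = sndF c := by simp [zsOf]

/-- `wOf ⟨x, c⟩ = ⟨x, fstF c⟩`. [folklore] -/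
@[simp] theorem wOf_boolPair (x c : List Bool) : wOf (boolPair x c) = boolPair x (fstF c) := by
  simp [wOf]

/-- `xOf ∈ FP`. [folklore] -/
theorem xOf_mem_FP : xOf ∈ FP := fstF_mem_FP
/-- `yOf ∈ FP`. [folklore] -/
theorem yOf_mem_FP : yOf ∈ FP := comp_mem_FP fstF_mem_FP sndF_mem_FP
/-- `zsOf ∈ FP`. [folklore] -/
theorem zsOf_mem_FP : zsOf ∈ FP := comp_mem_FP sndF_mem_FP sndF_mem_FP
/-- `wOf ∈ FP`. [folklore] -/
theorem wOf_mem_FP : wOf ∈ FP := fanoutFn_mem_FP xOf_mem_FP yOf_mem_FP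

/-- `|wOf X₀| ≤ |X₀| + 2` on every string. [folklore] -/
theorem length_wOf_le (X₀ : List Bool) : (wOf X₀).length ≤ X₀.length + 2 := by
  have h1 := length_fstF_sndF_le X₀
  have h2 := length_fstF_sndF_le (sndF X₀)
  have : wOf X₀ = boolPair (fstF X₀) (fstF (sndF X₀)) := by simp [wOf, xOf, yOf]
  rw [this, length_boolPair]
  omega

/-- `|zsOf X₀| ≤ |X₀|` on every string. [folklore] -/
theorem length_zsOf_le (X₀ : List Bool) : (zsOf X₀).length ≤ X₀.length := by
  have h1 := length_fstF_sndF_le X₀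
  have h2 := length_fstF_sndF_le (sndF X₀)
  simp only [zsOf, Function.comp_apply]
  omega

/-! ### The round words and the generator -/

/-- **The round word** `item x c j = ⟨⟨⟨x, Y⟩, 1ʲ⟩, Zs[j]⟩` for `c` read as `⟨Y, Zs⟩`
(`Y = fstF c`, `Zs[j] = elemOf (sndF c) j`). [folklore] -/
def item (x c : List Bool) (j : ℕ) : List Bool :=
  boolPair (boolPair (boolPair x (fstF c)) (ones j)) (elemOf (sndF c) j)

/-- **The piece function** of the generator: `⟨X₀, J⟩ ↦ ⟨⟨⟨wOf X₀, J⟩, (zsOf X₀)[|J|]⟩, ε⟩`, the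
one-entry code of a round word. [folklore] -/
noncomputable def pieceFn : List Bool → List Bool :=
  fanoutFn (fanoutFn (fanoutFn (wOf ∘ fstF) sndF) (elemFn ∘ fanoutFn sndF (zsOf ∘ fstF))) fun _ => []

/-- `pieceFn ∈ FP`. [folklore] -/
theorem pieceFn_mem_FP : pieceFn ∈ FP :=
  fanoutFn_mem_FP
    (fanoutFn_mem_FP (fanoutFn_mem_FP (comp_mem_FP wOf_mem_FP fstF_mem_FP) sndF_mem_FP)
      (comp_mem_FP elemFn_mem_FP (fanoutFn_mem_FP sndF_mem_FP (comp_mem_FP zsOf_mem_FP fstF_mem_FP))))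
    (const_mem_FP [])

/-- Value of the piece function on a pair. [folklore] -/
theorem pieceFn_apply (X₀ J : List Bool) :
    pieceFn (boolPair X₀ J) =
      boolPair (boolPair (boolPair (wOf X₀) J) (elemOf (zsOf X₀) J.length)) [] := by
  simp [pieceFn, elemFn_boolPair]

/-- The piece of round `j` of `⟨x, c⟩` is the one-entry code of `item x c j`. [folklore] -/
theorem pieceFn_boolPair_ones (x c : List Bool) (j : ℕ) :
    pieceFn (boolPair (boolPair x c) (ones j)) = boolPair (item x c j) [] := by
  rw [pieceFn_apply, wOf_boolPair, zsOf_boolPair, item]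
  simp [ones]

/-- **Size of the pieces**: `|pieceFn ⟨X₀, J⟩| ≤ 10 |X₀| + 4 |J| + 30`. [folklore] -/
theorem length_pieceFn_le (X₀ J : List Bool) :
    (pieceFn (boolPair X₀ J)).length ≤ 10 * X₀.length + 4 * J.length + 30 := by
  rw [pieceFn_apply]
  simp only [length_boolPair, List.length_nil]
  have h1 := length_wOf_le X₀
  have h2 := (length_elemOf_le (zsOf X₀) J.length).trans (length_zsOf_le X₀)
  omega

/-- The initial record of the generator loop: `⟨X₀, ⟨bin |wOf X₀|, ⟨ε, ε⟩⟩⟩`. [folklore] -/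
noncomputable def genInit : List Bool → List Bool :=
  fanoutFn id (fanoutFn (lenBinF ∘ wOf) fun _ => boolPair [] [])

/-- `genInit ∈ FP`. [folklore] -/
theorem genInit_mem_FP : genInit ∈ FP :=
  fanoutFn_mem_FP OracleCompose.id_mem_FP
    (fanoutFn_mem_FP (comp_mem_FP lenBinF_mem_FP wOf_mem_FP) (const_mem_FP _))

/-- Value of `genInit`. [folklore] -/
theorem genInit_apply (X₀ : List Bool) :
    genInit X₀ = boolPair X₀ (boolPair (encodeNat (wOf X₀).length) (boolPair (ones 0) [])) := by
  simp [genInit, ones]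

/-- **The generator**: `|wOf X₀|` rounds of the clipped concatenation fold of `pieceFn`, then the
accumulator. [cite: AroraBarakCC2009, §1.3 (bounded loops)] -/
noncomputable def genFn : List Bool → List Bool :=
  sndPow 2 ∘ foldLoop appF (clipF 38 pieceFn) (X + Polynomial.C 2) ∘ genInit

/-- **`genFn ∈ FP`.** [cite: AroraBarakCC2009, §1.3 (bounded loops)] -/
theorem genFn_mem_FP : genFn ∈ FP :=
  comp_mem_FP (sndPow_mem_FP 2)
    (comp_mem_FP (foldLoop_clipF_mem_FP 38 appF_mem_FP length_appF_le pieceFn_mem_FP _) genInit_mem_FP)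

/-- **Value of the generator on `⟨x, c⟩`**: the concatenation of the one-entry codes
`⟨item x c j, ε⟩`, `j < |⟨x, fstF c⟩|`. [folklore] -/
theorem genFn_apply (x c : List Bool) :
    genFn (boolPair x c) =
      ccat (fun j => boolPair (item x c j) []) (boolPair x (fstF c)).length := by
  set X₀ := boolPair x c with hX₀
  set k := (boolPair x (fstF c)).length with hk
  have hw : wOf X₀ = boolPair x (fstF c) := by rw [hX₀, wOf_boolPair]
  have hkle : k ≤ (X + Polynomial.C 2).eval X₀.length := by
    have := length_wOf_le X₀
    rw [hw] at this
    simp only [eval_add, eval_X, eval_C]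
    exact this
  have hfold := foldLoop_apply appF (clipF 38 pieceFn) hkle 0 []
  simp only [genFn, Function.comp_apply, genInit_apply, hw, ← hk]
  rw [hfold, sndPow_succ_boolPair, sndPow_succ_boolPair, sndPow_zero_boolPair]
  rw [foldAcc_clipF, foldAcc_appF, List.nil_append]
  · refine ccat_congr fun j _ => ?_
    rw [Nat.zero_add, hX₀, pieceFn_boolPair_ones]
  · intro j _ hj
    have hlen := length_pieceFn_le X₀ (ones j)
    have hj' : j < X₀.length + 2 := by
      have := length_wOf_le X₀
      rw [hw] at this
      omega
    simp only [ones, List.length_replicate] at hlen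
    nlinarith [hlen, hj']

/-- The generator's value as a `flatMap` over the list of round words. [folklore] -/
theorem genFn_boolPair_eq_flatMap (x c : List Bool) :
    genFn (boolPair x c) =
      ((List.range (boolPair x (fstF c)).length).map (item x c)).flatMap fun e => boolPair e [] := by
  rw [genFn_apply, ccat_eq_flatMap_range, List.flatMap_map]

/-! ### The round analyser -/

section Analyser

variable (R S : Language Bool) (f : List Bool → List Bool) (p : Polynomial ℕ)

/-- `Oracle.ofLanguage L` — the string-valued indicator `w ↦ [w ∈ L]` of `Oracle.lean` — is in `FP`
for `L ∈ P` (the deciding machine itself, `indicatorFn_mem_FP`). [cite: AroraBarakCC2009, Def. 1.13] -/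
theorem ofLanguage_mem_FP_of_mem_P {L : Language Bool} (hL : L ∈ Classes.P) : Oracle.ofLanguage L ∈ FP :=
  indicatorFn_mem_FP hL

/-- `Oracle.ofLanguage L` is one-bit (`PRelSigma.ofLanguage_eq_singleton`). [folklore] -/
theorem oneBit_ofLanguage (L : Language Bool) : OneBit (Oracle.ofLanguage L) := fun w =>
  ⟨_, PRelSigma.ofLanguage_eq_singleton L w⟩

open Classical in
/-- Value of `Oracle.ofLanguage` as a decision bit. [folklore] -/
theorem ofLanguage_apply_decide (L : Language Bool) (w : List Bool) :
    Oracle.ofLanguage L w = [decide (w ∈ L)] := by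
  rw [PRelSigma.ofLanguage_eq_singleton]
  by_cases h : w ∈ L
  · rw [(Set.mem_iff_boolIndicator _ _).1 h, decide_eq_true h]
  · rw [(Set.notMem_iff_boolIndicator _ _).1 h, decide_eq_false h]

/-- **The guard** of a round word `⟨⟨w, J⟩, z⟩`, `w = ⟨x, Y⟩`: `[|Y| ≤ p(|x|) ∧ w ∈ R]`. [folklore] -/
noncomputable def guardFn : List Bool → List Bool :=
  andFn (lenLeFn p ∘ fstF ∘ fstF) (Oracle.ofLanguage R ∘ fstF ∘ fstF)

/-- `guardFn` is one-bit. [folklore] -/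
theorem oneBit_guardFn : OneBit (guardFn R p) :=
  oneBit_andFn (fun u => by
    rcases lenLeFn_eq_or p (fstF (fstF u)) with h | h
    · exact ⟨true, h⟩
    · exact ⟨false, h⟩) ((oneBit_ofLanguage R).comp _)

/-- `guardFn R p ∈ FP` for `R ∈ P`. [folklore] -/
theorem guardFn_mem_FP (hR : R ∈ Classes.P) : guardFn R p ∈ FP :=
  andFn_mem_FP (comp_mem_FP (lenLeFn_mem_FP p) (comp_mem_FP fstF_mem_FP fstF_mem_FP))
    (comp_mem_FP (ofLanguage_mem_FP_of_mem_P hR) (comp_mem_FP fstF_mem_FP fstF_mem_FP))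

open Classical in
/-- Value of the guard on a round word. [folklore] -/
theorem guardFn_apply (x Y J z : List Bool) :
    guardFn R p (boolPair (boolPair (boolPair x Y) J) z) =
      [decide (Y.length ≤ p.eval x.length ∧ boolPair x Y ∈ R)] := by
  rw [guardFn, andFn_apply (b := decide (Y.length ≤ p.eval x.length)) (b' := decide (boolPair x Y ∈ R))]
  · rw [Bool.decide_and]
  · simp [lenLeFn_boolPair]
  · simp [ofLanguage_apply_decide, -Oracle.ofLanguage_apply]

/-- **The round analyser** `g1Fn R S f p` (see the module docstring). [folklore] -/
noncomputable def g1Fn : List Bool → List Bool :=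
  iteFn (guardFn R p)
    (iteFn (Oracle.ofLanguage S ∘ fstF) (fanoutFn (f ∘ fstF) (List.cons true ∘ sndF)) fun _ => boolPair [false] [false])
    fun _ => boolPair [true] [false]

/-- **`g1Fn R S f p ∈ FP`** for `R, S ∈ P` and `f ∈ FP`. [cite: AroraBarakCC2009, §1.3] -/
theorem g1Fn_mem_FP (hR : R ∈ Classes.P) (hS : S ∈ Classes.P) (hf : f ∈ FP) : g1Fn R S f p ∈ FP :=
  iteFn_mem_FP (guardFn_mem_FP R p hR)
    (iteFn_mem_FP (comp_mem_FP (ofLanguage_mem_FP_of_mem_P hS) fstF_mem_FP)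
      (fanoutFn_mem_FP (comp_mem_FP hf fstF_mem_FP) (comp_mem_FP (cons_mem_FP true) sndF_mem_FP))
      (const_mem_FP _))
    (const_mem_FP _)

open Classical in
/-- **The clock word of the round analyser** on `⟨⟨w, J⟩, z⟩`, `w = ⟨x, Y⟩`: the query `f ⟨w, J⟩`
of a task, the bit `0` of an idle round, the bit `1` of a complaint. [folklore] -/
noncomputable def g1T (x Y J : List Bool) : List Bool :=
  if Y.length ≤ p.eval x.length ∧ boolPair x Y ∈ R then
    if boolPair (boolPair x Y) J ∈ S then f (boolPair (boolPair x Y) J) else [false]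
  else [true]

open Classical in
/-- **The flagged certificate of the round analyser**: `1 z` for a task, `[0]` otherwise. [folklore] -/
noncomputable def g1U (x Y J z : List Bool) : List Bool :=
  if Y.length ≤ p.eval x.length ∧ boolPair x Y ∈ R then
    if boolPair (boolPair x Y) J ∈ S then true :: z else [false]
  else [false]

open Classical in
/-- **Value of the round analyser on a round word**: `⟨g1T, g1U⟩`. [folklore] -/
theorem g1Fn_apply (x Y J z : List Bool) :
    g1Fn R S f p (boolPair (boolPair (boolPair x Y) J) z) =
      boolPair (g1T R S f p x Y J) (g1U R S p x Y J z) := by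
  rw [g1Fn, iteFn_apply (guardFn_apply R p x Y J z), g1T, g1U]
  by_cases hg : Y.length ≤ p.eval x.length ∧ boolPair x Y ∈ R
  · rw [decide_eq_true hg, if_pos rfl, if_pos hg, if_pos hg,
      iteFn_apply (b := decide (boolPair (boolPair x Y) J ∈ S)) (by simp [ofLanguage_apply_decide, -Oracle.ofLanguage_apply])]
    by_cases hs : boolPair (boolPair x Y) J ∈ S
    · rw [decide_eq_true hs, if_pos rfl, if_pos hs, if_pos hs]
      simp
    · rw [decide_eq_false hs, if_neg hs, if_neg hs]
      simp
  · rw [decide_eq_false hg, if_neg hg, if_neg hg]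
    simp

open Classical in
/-- The clock word is the query of the round when the length guard holds, and a single bit
otherwise or on idle rounds: `|g1T| ≤ [|Y| ≤ p(|x|)] · |f ⟨w, J⟩| + 1`. [folklore] -/
theorem length_g1T_le (x Y J : List Bool) :
    (g1T R S f p x Y J).length ≤
      (if Y.length ≤ p.eval x.length then (f (boolPair (boolPair x Y) J)).length else 0) + 1 := by
  unfold g1T
  split_ifs with h1 h2 h3 <;> simp_all

/-- The flagged certificate is at most one symbol longer than the certificate. [folklore] -/
theorem length_g1U_le (x Y J z : List Bool) : (g1U R S p x Y J z).length ≤ z.length + 1 := by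
  unfold g1U
  split_ifs <;> simp

end Analyser

/-! ### The flag reader -/

/-- **The flag reader** `g2Fn`: `⟨t, 1 z⟩ ↦ 1 ⟨t, z⟩`, `⟨t, 0 _⟩ ↦ [0, t.head]` (and `⟨t, ε⟩`
likewise). [folklore] -/
noncomputable def g2Fn : List Bool → List Bool :=
  iteFn (HashBricks.headBitFn ∘ sndF) (List.cons true ∘ fanoutFn fstF (List.tail ∘ sndF))
    (List.cons false ∘ HashBricks.headBitFn ∘ fstF)

/-- **`g2Fn ∈ FP`.** [cite: AroraBarakCC2009, §1.3] -/
theorem g2Fn_mem_FP : g2Fn ∈ FP :=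
  iteFn_mem_FP (comp_mem_FP HashBricks.headBitFn_mem_FP sndF_mem_FP)
    (comp_mem_FP (cons_mem_FP true) (fanoutFn_mem_FP fstF_mem_FP (comp_mem_FP PRelSigma.tail_mem_FP sndF_mem_FP)))
    (comp_mem_FP (cons_mem_FP false) (comp_mem_FP HashBricks.headBitFn_mem_FP fstF_mem_FP))

/-- A run word: `g2Fn ⟨t, 1 z⟩ = 1 ⟨t, z⟩`. [folklore] -/
theorem g2Fn_true (t z : List Bool) : g2Fn (boolPair t (true :: z)) = true :: boolPair t z := by
  rw [g2Fn, iteFn_apply_true (by simp)]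
  simp

/-- An idle word: `g2Fn ⟨t, 0 z⟩ = [0, t.head]`. [folklore] -/
theorem g2Fn_false (t z : List Bool) : g2Fn (boolPair t (false :: z)) = [false, t.headD false] := by
  rw [g2Fn, iteFn_apply_false (by simp)]
  simp

end GuardedBall

end Literature.Computability.Complexity
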